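import Literature.NumberTheory.EllipticCurves.IwasawaSelmerDualFunctorialityProofs
import Literature.NumberTheory.EllipticCurves.IwasawaAlgebra
import HarnessLib

/-!
# Route `SignedLowerHalves`, crux L `SmallImageLowerHalfBothSigns` (stmt-BirchSwinnertonDyer-23599), line `rtt_w3` v14 — E2, row (5′) `Col`,
# part (E1): PONTRYAGIN DUAL OF A FINITE PRODUCT — an additive `S₁ ≃+ (Fin d → S₂)` intertwining locally nilpotent operators `ψ₁`, `ψ₂`
# identifies ANY pinned `Λ`-dual `X₁ ≅ Hom(S₁, ℚ/ℤ)` with `(Hom(S₂, ℚ/ℤ))^d`, `Λ = ℤ_p⟦T⟧`-LINEARLY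

WIDTH seat `bsd-line-slh-p3-w3` g21 under LEAD `cruxlead-stmt-BirchSwinnertonDyer-23599` g11 (cell `bsd-ssimc`); helper
`--supports stmt-BirchSwinnertonDyer-23599`. THEOREMS + one generic auxiliary definition (`dualPiEquiv`); no named fact, no instance, no `sorry`.
Nothing about E2 / crux L / BSD is asserted or proved here.

WHY (row (5′) by the COORDINATE route, parts (A)–(E); this is the algebra of (E)). Parts (C)+(D) give an additive isomorphism
`Φ : E^{ε}_{sat,v}(M) ≃+ (Fin d → ℋ^ε)` commuting with the conjugations by `γ_v`; the stub's `DQ : LocalCondDualData …` is an ABSTRACT `Λ`-module `DQ.X`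
pinned to `Hom(E^{ε}_{sat,v}(M), ℚ/ℤ)` by a bijection `toDual` under which `T` acts as `conj_{γ_v} − 1` and constants through `ℤ_p → ℤ/pᵏ` — hence
(forcing lemma `LocalCondDualData.toDual_smul_eq_smulFun`, -w3 g20) `toDual (f • x) = f ⋆ toDual x` for EVERY power series `f`, `⋆` the tree's
canonical action `IwasawaDual.IsLocNil.smulFun`; and `XLoc = Hom(ℋ^ε, ℚ/ℤ)` carries `IsLocNil.module` (`•` IS `⋆`). This file proves, for such data in
general: ★★ `dualPiEquiv : X₁ ≃ₗ[Λ] (Fin d → (S₂ →+ ℚ/ℤ))` — assembled from the tree's `Λ`-linear transposes `IwasawaDual.dualLinearMap` of the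
coordinate maps `proj_i ∘ Φ : S₁ → S₂` and `Φ⁻¹ ∘ single_i : S₂ → S₁` (both intertwine `ψ₁`, `ψ₂`), the two compositions being the identity because
`Σ_i single_i ∘ proj_i = id` and `proj_i ∘ single_k = δ_{ik}` (checked after `toDual`, which is injective). Consequence ★ `moduleFree_and_finrank_of_dualPiEquiv`:
if `Hom(S₂, ℚ/ℤ)` is `Λ`-free of rank `r` then `X₁` is `Λ`-free of rank `d·r` (and finite).
References: [Washington1997] §13.2 (Pontryagin duality); [GreenbergLNM1716] §1 (p. 60) (the `Λ`-structure through `γ`); [NeukirchSchmidtWingberg2008] (5.2.?)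
finite products of discrete modules.
-/

set_option autoImplicit false
set_option linter.dupNamespace false -- D-0017: single-problem summit, the namespace repeats the problem name by design
noncomputable section

open scoped Classical

namespace Summit.BirchSwinnertonDyer.BirchSwinnertonDyer.Theorems.SmallImageRttD2Seq

open Literature.NumberTheory.EllipticCurves Literature.NumberTheory.EllipticCurves.IwasawaDual

section DualPi

variable {p : ℕ} [Fact p.Prime] {S₁ : Type*} {S₂ : Type*} [AddCommGroup S₁] [AddCommGroup S₂]
  {ψ₁ : AddMonoid.End S₁} {ψ₂ : AddMonoid.End S₂} (h₁ : IsLocNil p ψ₁) (h₂ : IsLocNil p ψ₂)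
  {X₁ : Type*} [AddCommGroup X₁] [Module (IwasawaAlgebra p) X₁]
  (toDual₁ : X₁ →+ (S₁ →+ AddCircle (1 : ℚ))) (hbij₁ : Function.Bijective toDual₁)
  (hsmul₁ : ∀ (f : IwasawaAlgebra p) (x : X₁), toDual₁ (f • x) = h₁.smulFun f (toDual₁ x))
  {d : ℕ} (Φ : S₁ ≃+ (Fin d → S₂)) (hΦ : ∀ (s : S₁) (i : Fin d), Φ (ψ₁ s) i = ψ₂ (Φ s i))

/-- The `i`-th coordinate map `proj_i ∘ Φ : S₁ → S₂`. [cite: Washington1997, §13.2] -/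
def coordHom (i : Fin d) : S₁ →+ S₂ :=
  (Pi.evalAddMonoidHom (fun _ : Fin d ↦ S₂) i).comp Φ.toAddMonoidHom

/-- The `i`-th co-coordinate map `Φ⁻¹ ∘ single_i : S₂ → S₁`. [cite: Washington1997, §13.2] -/
def cocoordHom (i : Fin d) : S₂ →+ S₁ :=
  Φ.symm.toAddMonoidHom.comp (AddMonoidHom.single (fun _ : Fin d ↦ S₂) i)

omit [Fact p.Prime] in
/-- Unfolding `coordHom`. [cite: Washington1997, §13.2] -/
@[simp]
theorem coordHom_apply (i : Fin d) (s : S₁) : coordHom Φ i s = Φ s i :=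
  rfl

omit [Fact p.Prime] in
/-- Unfolding `cocoordHom`. [cite: Washington1997, §13.2] -/
@[simp]
theorem cocoordHom_apply (i : Fin d) (s : S₂) : cocoordHom Φ i s = Φ.symm (Pi.single i s) :=
  rfl

omit [Fact p.Prime] in
include hΦ in
/-- `proj_i ∘ Φ` intertwines `ψ₁` and `ψ₂`. [cite: GreenbergLNM1716, §1 (p. 60)] -/
theorem coordHom_comm (i : Fin d) (s : S₁) : coordHom Φ i (ψ₁ s) = ψ₂ (coordHom Φ i s) := by
  rw [coordHom_apply, coordHom_apply, hΦ]

omit [Fact p.Prime] in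
include hΦ in
/-- `Φ⁻¹ ∘ single_i` intertwines `ψ₂` and `ψ₁`. [cite: GreenbergLNM1716, §1 (p. 60)] -/
theorem cocoordHom_comm (i : Fin d) (s : S₂) : cocoordHom Φ i (ψ₂ s) = ψ₁ (cocoordHom Φ i s) := by
  rw [cocoordHom_apply, cocoordHom_apply]
  apply Φ.injective
  rw [Φ.apply_symm_apply]
  funext k
  rw [hΦ, Φ.apply_symm_apply]
  by_cases hk : k = i
  · subst hk; rw [Pi.single_eq_same, Pi.single_eq_same]
  · rw [Pi.single_eq_of_ne hk, Pi.single_eq_of_ne hk, map_zero]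

omit [Fact p.Prime] in
/-- `proj_i Φ Φ⁻¹ single_k = δ_{ik}`. [cite: Washington1997, §13.2] -/
theorem coordHom_cocoordHom (i k : Fin d) (s : S₂) : coordHom Φ i (cocoordHom Φ k s) = if i = k then s else 0 := by
  rw [coordHom_apply, cocoordHom_apply, Φ.apply_symm_apply]
  by_cases hik : i = k
  · subst hik; rw [Pi.single_eq_same, if_pos rfl]
  · rw [Pi.single_eq_of_ne hik, if_neg hik]

omit [Fact p.Prime] in
/-- `Σ_i Φ⁻¹ single_i proj_i Φ = id`. [cite: Washington1997, §13.2] -/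
theorem sum_symm_single_apply (s : S₁) : ∑ i, Φ.symm (Pi.single i (Φ s i)) = s := by
  rw [← map_sum, Finset.univ_sum_single (Φ s), Φ.symm_apply_apply]

/-- The `Λ`-linear transpose `X₂ = Hom(S₂, ℚ/ℤ) → X₁` of `proj_i ∘ Φ` (for the canonical structure `h₂.module` on `X₂` and the pinned one on `X₁`).
[cite: GreenbergLNM1716, §1 (p. 60)] -/
def coordDual (i : Fin d) : letI := h₂.module (A := AddCircle (1 : ℚ)); (S₂ →+ AddCircle (1 : ℚ)) →ₗ[IwasawaAlgebra p] X₁ :=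
  letI := h₂.module (A := AddCircle (1 : ℚ))
  dualLinearMap toDual₁ hbij₁ (AddMonoidHom.id (S₂ →+ AddCircle (1 : ℚ))) (coordHom Φ i) h₁ h₂ hsmul₁ (fun _ _ ↦ rfl) (coordHom_comm Φ hΦ i)

/-- The `Λ`-linear transpose `X₁ → X₂ = Hom(S₂, ℚ/ℤ)` of `Φ⁻¹ ∘ single_i`. [cite: GreenbergLNM1716, §1 (p. 60)] -/
def cocoordDual (i : Fin d) : letI := h₂.module (A := AddCircle (1 : ℚ)); X₁ →ₗ[IwasawaAlgebra p] (S₂ →+ AddCircle (1 : ℚ)) :=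
  letI := h₂.module (A := AddCircle (1 : ℚ))
  dualLinearMap (AddMonoidHom.id (S₂ →+ AddCircle (1 : ℚ))) Function.bijective_id toDual₁ (cocoordHom Φ i) h₂ h₁ (fun _ _ ↦ rfl) hsmul₁
    (cocoordHom_comm Φ hΦ i)

/-- `toDual₁ (coordDual i y) s = y (Φ s i)`. [cite: Washington1997, §13.2] -/
theorem toDual_coordDual_apply (i : Fin d) (y : S₂ →+ AddCircle (1 : ℚ)) (s : S₁) :
    toDual₁ (coordDual h₁ h₂ toDual₁ hbij₁ hsmul₁ Φ hΦ i y) s = y (Φ s i) := by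
  letI := h₂.module (A := AddCircle (1 : ℚ))
  change toDual₁ (dualHom toDual₁ hbij₁ (AddMonoidHom.id (S₂ →+ AddCircle (1 : ℚ))) (coordHom Φ i) y) s = _
  rw [toDual_dualHom_apply]
  rfl

/-- `cocoordDual i x s = toDual₁ x (Φ⁻¹ (single_i s))`. [cite: Washington1997, §13.2] -/
theorem cocoordDual_apply (i : Fin d) (x : X₁) (s : S₂) :
    cocoordDual h₁ h₂ toDual₁ hsmul₁ Φ hΦ i x s = toDual₁ x (Φ.symm (Pi.single i s)) := by
  letI := h₂.module (A := AddCircle (1 : ℚ))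
  change (AddMonoidHom.id _) (dualHom (AddMonoidHom.id (S₂ →+ AddCircle (1 : ℚ))) Function.bijective_id toDual₁ (cocoordHom Φ i) x) s = _
  rw [toDual_dualHom_apply]
  rfl

/-- ★★ **`X₁ ≃ₗ[Λ] (Fin d → Hom(S₂, ℚ/ℤ))`**: the pinned `Λ`-dual of `S₁ ≅ S₂^d` is the product of the canonical `Λ`-duals of `S₂`
(`x ↦ (toDual₁ x ∘ Φ⁻¹ ∘ single_i)_i`, inverse `(y_i) ↦ toDual₁⁻¹ (Σ_i y_i ∘ proj_i ∘ Φ)`). [cite: Washington1997, §13.2] [cite: GreenbergLNM1716, §1 (p. 60)] -/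
def dualPiEquiv : letI := h₂.module (A := AddCircle (1 : ℚ)); X₁ ≃ₗ[IwasawaAlgebra p] (Fin d → (S₂ →+ AddCircle (1 : ℚ))) :=
  letI := h₂.module (A := AddCircle (1 : ℚ))
  LinearEquiv.ofLinear
    (LinearMap.pi fun i ↦ cocoordDual h₁ h₂ toDual₁ hsmul₁ Φ hΦ i)
    (∑ i, (coordDual h₁ h₂ toDual₁ hbij₁ hsmul₁ Φ hΦ i).comp (LinearMap.proj i))
    (by
      apply LinearMap.ext
      intro y
      funext i
      ext s
      rw [LinearMap.comp_apply, LinearMap.id_apply, LinearMap.pi_apply, cocoordDual_apply, LinearMap.sum_apply, map_sum,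
        AddMonoidHom.finsetSum_apply]
      simp only [LinearMap.comp_apply, LinearMap.proj_apply, toDual_coordDual_apply, Φ.apply_symm_apply]
      rw [Finset.sum_eq_single i (fun k _ hki ↦ by rw [Pi.single_eq_of_ne hki, map_zero]) (fun h ↦ absurd (Finset.mem_univ i) h),
        Pi.single_eq_same])
    (by
      apply LinearMap.ext
      intro x
      rw [LinearMap.comp_apply, LinearMap.id_apply, LinearMap.sum_apply]
      apply hbij₁.1
      ext s
      rw [map_sum, AddMonoidHom.finsetSum_apply]
      simp only [LinearMap.comp_apply, LinearMap.proj_apply, LinearMap.pi_apply, toDual_coordDual_apply, cocoordDual_apply]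
      rw [← map_sum, sum_symm_single_apply])

/-- Unfolding `dualPiEquiv`: the `i`-th coordinate of the image of `x` is the character `s ↦ toDual₁ x (Φ⁻¹ (single_i s))`. [cite: Washington1997, §13.2] -/
theorem dualPiEquiv_apply (x : X₁) (i : Fin d) (s : S₂) :
    (letI := h₂.module (A := AddCircle (1 : ℚ)); dualPiEquiv h₁ h₂ toDual₁ hbij₁ hsmul₁ Φ hΦ x i s) = toDual₁ x (Φ.symm (Pi.single i s)) :=
  cocoordDual_apply h₁ h₂ toDual₁ hsmul₁ Φ hΦ i x s

include hbij₁ hsmul₁ hΦ in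
/-- ★ **Freeness and rank transfer**: if `Hom(S₂, ℚ/ℤ)` with its canonical `Λ`-structure is free of rank `r`, then the pinned dual `X₁` of `S₁ ≅ S₂^d`
is `Λ`-free and finite of rank `d · r`. [cite: Washington1997, §13.2] [cite: GreenbergLNM1716, §1 (p. 60)] -/
theorem moduleFree_and_finrank_of_dualPiEquiv {r : ℕ}
    (hfree : letI := h₂.module (A := AddCircle (1 : ℚ)); Module.Free (IwasawaAlgebra p) (S₂ →+ AddCircle (1 : ℚ)))
    (hrank : letI := h₂.module (A := AddCircle (1 : ℚ)); Module.finrank (IwasawaAlgebra p) (S₂ →+ AddCircle (1 : ℚ)) = r) (hr : 0 < r) :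
    Module.Free (IwasawaAlgebra p) X₁ ∧ Module.Finite (IwasawaAlgebra p) X₁ ∧ Module.finrank (IwasawaAlgebra p) X₁ = d * r := by
  letI := h₂.module (A := AddCircle (1 : ℚ))
  haveI := hfree
  haveI : Module.Finite (IwasawaAlgebra p) (S₂ →+ AddCircle (1 : ℚ)) := Module.finite_of_finrank_pos (by rw [hrank]; exact hr)
  let e := dualPiEquiv h₁ h₂ toDual₁ hbij₁ hsmul₁ Φ hΦ
  refine ⟨Module.Free.of_equiv e.symm, Module.Finite.equiv e.symm, ?_⟩
  rw [e.finrank_eq, Module.finrank_pi_fintype, Finset.sum_const, Finset.card_univ, Fintype.card_fin, hrank, smul_eq_mul]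

end DualPi

end Summit.BirchSwinnertonDyer.BirchSwinnertonDyer.Theorems.SmallImageRttD2Seq

end
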